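import Summits.ABC.IUTFork.Joshi.DictionaryThetaLoci
import HarnessLib

/-!
# Dictionary row D-11 (Joshi's theta-values loci read in OUR packets) AT THE PINNED COUNTERMODEL — «J-FALSE-AT-PINNED» data

Test-side companion of `Joshi/DictionaryThetaLoci.lean` (abc-iut cell, branch E, rung LADDER-ABC:A2.E; seat abc-iut-E-t22;
plan/E/E-PLAN.md R13: results of this kind are «J-FALSE-AT-PINNED» data for the test ledger, NOT a COUNTERMODEL verdict, and
R9/R14: they bind no TEST line by themselves — E-cx places them). Logic only, over landed decls BY NAME:
`Cor312Vol.PinnedWitness.pinnedSetting p` (the pinned countermodel of record, p419720: typed Thm 3.11 + bridge hypotheses +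
the three pins hold, S = `PilotKummerIndRelated` and the (xi-f) licence FAIL — `pinnedSetting_not_licence`; Joshi's volume
shape SVB fails — `pinnedSetting_not_subsetVolumeBound`, `Joshi/TestHarness.lean`) and the D-11 glue of
`Joshi/DictionaryThetaLoci.lean` (`licence_of_locusWithinHull`, `subsetVolumeBound_of_locusWithinHull`).

WHAT IS RECORDED. At `pinnedSetting p` — for EVERY loci signature `C : ATS3.TensorPacketLociDatum …` (arXiv:2401.13508v4
Thm-Def 9.8.1.1), EVERY seed dictionary `𝔇`, EVERY reading `R : LociReading (pinnedSetting p) C 𝔇`, region operator `ρ` and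
q-datum `qK`: if the standard point's datum is read inside Joshi's locus (`StdDatumWithinLocus`, OUR READING of `z_Θ ∈ Σ̃_{L′}`)
and is the q-pilot's (`StandardPointIsQPilot` + the q-pin, resp. the faithful size form `StandardPointHasQPilotVolume` +
admissibility), then the hull-level row D-11 `LocusWithinHull` — and a fortiori the identification-level row
`LocusWithinPossibleImages` (Joshi's «are Mochizuki's multi-radial representations», Thm-Def 9.8.1.1 (7) p.116 l.43–50) —
FAILS there. Equivalently: where S fails, Joshi's locus, once it carries the q-pilot, cannot sit inside `^{n,∘}𝒰`. This LOCATES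
the row; it adjudicates nothing (the pinned model is a toy-level witness of record; no side taken on [IUTchIII] Cor. 3.12, on
Joshi's claims or on Mochizuki's report). [claim: Joshi2024ATS3, status: disputed]
-/

noncomputable section

namespace Summit.ABC.IUTFork.Joshi

open Thm311 Cor312 Cor312Vol Cor312Vol.PinnedWitness Cor312Vol.NaiveWitness

variable (p : ℕ) [hp : Fact p.Prime]
  (ρ : (∀ v : Cor312.Checks.toyIndex.V, v ∈ Cor312.Checks.toyIndex.Vbad → Set ((naiveFull p).L.StarPacket v)) →
    ∀ (j : Cor312.Checks.toyIndex.Label) (vQ : Cor312.Checks.toyIndex.VQ), Set ((naiveFull p).L.Packet j vQ))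
  (qK : ∀ v : Cor312.Checks.toyIndex.V, v ∈ Cor312.Checks.toyIndex.Vbad → Set ((naiveFull p).L.StarPacket v))
  {W : Type} {V : W → Type} [∀ w, TopologicalSpace (V w)] {TJ TM : Type} [TopologicalSpace TJ] [TopologicalSpace TM]
  {C : ATS3.TensorPacketLociDatum W V TJ TM} {𝔇 : Dictionary (naiveFull p).toLatticeSituation}
  (R : LociReading (pinnedSetting p) C 𝔇)

/-- **D-11 (hull level) is FALSE at the pinned countermodel** once the locus carries the q-pilot (region form): `StdDatumWithinLocus
∧ StandardPointIsQPilot ∧ QPinned ⟹ ¬ LocusWithinHull` at `pinnedSetting p` — because the (xi-f) licence fails there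
(`pinnedSetting_not_licence`). J-FALSE-AT-PINNED data (E-PLAN R13), logic only. [claim: Joshi2024ATS3, status: disputed] -/
theorem not_locusWithinHull_pinned (hstd : R.StdDatumWithinLocus ρ) (hY2 : StandardPointIsQPilot ρ qK 𝔇)
    (hq : QPinned (naiveFull p).toLatticeSituation (pinnedSetting p) ρ qK) : ¬ R.LocusWithinHull := fun hL =>
  pinnedSetting_not_licence p (R.licence_of_locusWithinHull ρ qK hL hstd hY2 hq)

/-- … hence the identification-level row `LocusWithinPossibleImages` (Joshi's «are Mochizuki's multi-radial representations»)
fails there too under the same readings. [claim: Joshi2024ATS3, status: disputed] -/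
theorem not_locusWithinPossibleImages_pinned (hstd : R.StdDatumWithinLocus ρ) (hY2 : StandardPointIsQPilot ρ qK 𝔇)
    (hq : QPinned (naiveFull p).toLatticeSituation (pinnedSetting p) ρ qK) : ¬ R.LocusWithinPossibleImages := fun hL =>
  not_locusWithinHull_pinned p ρ qK R hstd hY2 hq (R.locusWithinHull_of_locusWithinPossibleImages hL)

/-- **The same with the FAITHFUL size form of Y2** (no q-pin, no STRONGER-THAN-PRINT row): `StdDatumWithinLocus ∧
StandardPointHasQPilotVolume ∧ admissibility ⟹ ¬ LocusWithinHull` at `pinnedSetting p` — because Joshi's volume shape SVB fails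
there (`pinnedSetting_not_subsetVolumeBound`). J-FALSE-AT-PINNED data, logic only. [claim: Joshi2024ATS3, status: disputed] -/
theorem not_locusWithinHull_pinned_vol (hstd : R.StdDatumWithinLocus ρ)
    (hvol : StandardPointHasQPilotVolume ρ 𝔇 (P := pinnedSetting p))
    (hadm : ∀ (i : Fin Cor312.Checks.toyIndex.lstar) (vQ : Cor312.Checks.toyIndex.VQ),
      ((naiveFull p).D (pinnedSetting p).n).Adm (Setting.labelSucc i) vQ (ρ (𝔇.datum 𝔇.std) _ vQ)) :
    ¬ R.LocusWithinHull := fun hL =>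
  pinnedSetting_not_subsetVolumeBound p (R.subsetVolumeBound_of_locusWithinHull ρ hL hstd hvol hadm)

/-- Contrapositive placement for the test ledger: at the pinned countermodel any reading that keeps D-11 (hull level) must
drop `StdDatumWithinLocus` or the q-identification of the standard datum — the locus cannot both lie in `^{n,∘}𝒰` and carry the
q-pilot where S fails. [folklore] -/
theorem locusWithinHull_pinned_forces (hL : R.LocusWithinHull)
    (hq : QPinned (naiveFull p).toLatticeSituation (pinnedSetting p) ρ qK) :
    ¬ (R.StdDatumWithinLocus ρ ∧ StandardPointIsQPilot ρ qK 𝔇) := fun h =>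
  not_locusWithinHull_pinned p ρ qK R h.1 h.2 hq hL

end Summit.ABC.IUTFork.Joshi

end
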